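import Summits.CriticalPhenomena.SAWScalingLimit.Theorems.SAWDevelopingMapObservableToSLEChordalCarrierLimits

/-!
# Crux `SAWDevelopingMap.ObservableToSLE` (stmt-CriticalPhenomena-10472), line
`floor-ratio-restriction-bootstrap`, stub `stub_chordalCarrier`: reduction of the chordal-carrier
stub to ONE lattice estimate (uniform injectivity modulus) plus collar families

Landing target:
`Summits/CriticalPhenomena/SAWScalingLimit/Theorems/SAWDevelopingMapObservableToSLEChordalCarrierReduction.lean`
(`--supports stmt-CriticalPhenomena-10472`).  Sequel of
`SAWDevelopingMapObservableToSLEChordalCarrierLimits` (honesty, closed-set transfer, endpoints (E),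
confinement (C)).  PROVED here, for a probability subsequential limit law `μ` of the critical
hexagonal SAW curves in a Dobrushin domain `(D; a, b)`:

* (S) **simplicity from a uniform injectivity modulus** (`ae_mem_simple_of_uniformModulus`): IF for
  every `ε, η > 0` there is `θ > 0` with `P_δ(curve ∉ modulusClass ε θ) ≤ η` for all small `δ`
  (no `ε`-excursion of the walk closes up to Euclidean distance `θ`, uniformly in the mesh), THEN
  `μ`-a.e. class is simple — by the tree's description
  `simple = {source ≠ target} ∩ ⋂ₙ ⋃ₘ modulusClass (1/(n+1)) (1/(m+1))` through CLOSED modulus events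
  (`CurveClass.simple_eq_iInter`, `isClosed_modulusClass`) and the closed-set transfer.  The
  antecedent is the precise missing lattice estimate of the stub: the abstract statement "weak
  limits of laws carried by simple classes are carried by simple classes" is FALSE
  (`SimpleSubseqLimits.Negative.simple_not_isClosed`), so some quantitative input is needed, and
  this one is also NECESSARY in the portmanteau sense for limits carried by
  `⋃ₘ modulusClass ε (1/(m+1))`-full sets;
* (B) **hull containment and boundary avoidance** (`le_measureReal_rangeSubset_of_tendsto`,
  `ae_disjoint_range_of_tendsto`): if `P_δ(the walk is an Ω'-mesh walk) → p` then
  `p ≤ μ(trace ⊆ cl Ω')` (the lower half of the sandwich of stub 6), and if a closed `Z ⊆ ℂ` is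
  avoided by `cl Ω'_j` along a sequence with `p_j → 1` then `μ`-a.e. trace misses `Z`;
* the assembly `ae_mem_chordalCarrier` and the registered-shape reduction
  `stub_chordalCarrier_reduction`: the conclusion `∀ᵐ c ∂μ, c ∈ chordalCarrier D` of the stub follows
  from the uniform injectivity modulus and from collar families covering each boundary piece
  `frontierPiece D k`; on floor domains the latter is what the stub's hypothesis
  `FloorRestrictionLimit` supplies (hull subdomains of thin half-ellipse hulls, `Φ'_A(0) → 1`,
  `EllipseHulls.lean`), the former is OPEN.
-/

noncomputable section

open scoped Topology NNReal ENNReal BoundedContinuousFunction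
open Filter Set MeasureTheory Metric
open Literature.Probability.LatticeModels (HexVertex hexGraph hexCenter)
open Literature.Probability.RandomPlanarGeometry
open Literature.Probability.RandomPlanarGeometry.SAW

namespace Summit.CriticalPhenomena.SAWScalingLimit.Theorems.ObservableToSLE.FloorRatio

/-! ### (S) Simplicity of the limit classes from a uniform injectivity modulus -/

section Simplicity

variable {D : DobrushinDomain} {a b : ℝ → HexVertex} {μ : Measure (CurveClass ℂ)}

/-- **Simplicity from a uniform injectivity modulus (the isolated missing estimate).**
HYPOTHESIS (uniform injectivity modulus of the critical hexagonal SAW in `(D; a, b)`): for every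
`ε, η > 0` there is `θ > 0` such that for all small meshes `δ`, with `hexSAWLaw`-probability at
least `1 - η` the curve class of the walk lies in `CurveClass.modulusClass ε θ` — whenever two
points `γ(s), γ(t)` of the rescaled walk are `θ`-close, the arc between them stays within `ε` of
`γ(s)` (no `ε`-excursion closes up to distance `θ`: no macroscopic near-retracing, uniformly in
the mesh).  CONCLUSION: every probability subsequential limit law is carried by SIMPLE classes.
Proof: `simple = {source ≠ target} ∩ ⋂ₙ ⋃ₘ modulusClass (1/(n+1)) (1/(m+1))`
(`CurveClass.simple_eq_iInter`); the modulus events are closed (`isClosed_modulusClass`), so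
`μ(modulusClass εₙ θ) ≥ 1 - η` by the closed-set transfer, and the endpoints differ a.e. by (E).
[cite: AizenmanBurchard1999, §2.1 (the Borel space of curves; regularity passes to limits)] -/
theorem ae_mem_simple_of_uniformModulus [IsProbabilityMeasure μ]
    (hab : IsEmbEndpointApprox hexGraph hexCenter D a b)
    (hμ : IsSubseqLimitLaw (fun δ (γ : HexDomainSAW D.carrier δ (a δ) (b δ)) => γ.curve)
      (fun δ => hexSAWLaw D.carrier δ (a δ) (b δ)) μ)
    (hS : ∀ ε η : ℝ, 0 < ε → 0 < η → ∃ θ : ℝ, 0 < θ ∧ ∀ᶠ δ : ℝ in 𝓝[>] 0,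
      hexSAWLaw D.carrier δ (a δ) (b δ) {γ | γ.curve ∉ CurveClass.modulusClass ε θ} ≤
        ENNReal.ofReal η) :
    ∀ᵐ c ∂μ, c ∈ CurveClass.simple := by
  rw [CurveClass.simple_eq_iInter]
  have hmod : ∀ n : ℕ, ∀ᵐ c ∂μ,
      c ∈ ⋃ m : ℕ, CurveClass.modulusClass (E := ℂ) (1 / (n + 1 : ℝ)) (1 / (m + 1 : ℝ)) := by
    intro n
    set U : Set (CurveClass ℂ) :=
      ⋃ m : ℕ, CurveClass.modulusClass (1 / (n + 1 : ℝ)) (1 / (m + 1 : ℝ)) with hU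
    have hUm : MeasurableSet U :=
      MeasurableSet.iUnion fun m ↦ CurveClass.measurableSet_modulusClass _ _
    have hge : ∀ η : ℝ, 0 < η → 1 - η ≤ μ.real U := by
      intro η hη
      obtain ⟨θ, hθ, hev⟩ := hS (1 / (n + 1 : ℝ)) η (by positivity) hη
      obtain ⟨m, hm⟩ := exists_nat_one_div_lt hθ
      have hsub : CurveClass.modulusClass (E := ℂ) (1 / (n + 1 : ℝ)) θ ⊆ U :=
        (CurveClass.modulusClass_mono le_rfl hm.le).trans
          (subset_iUnion (fun m : ℕ ↦
            CurveClass.modulusClass (E := ℂ) (1 / (n + 1 : ℝ)) (1 / (m + 1 : ℝ))) m)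
      calc 1 - η ≤ μ.real (CurveClass.modulusClass (1 / (n + 1 : ℝ)) θ) := by
            refine le_measureReal_of_isClosed hμ (CurveClass.isClosed_modulusClass _ _)
              (hev.mono fun δ hδ hP ↦ ?_)
            haveI := hP
            have hbad : (hexSAWLaw D.carrier δ (a δ) (b δ)).real
                {γ | γ.curve ∉ CurveClass.modulusClass (1 / (n + 1 : ℝ)) θ} ≤ η :=
              ENNReal.toReal_le_of_le_ofReal hη.le hδ
            have hcompl : {γ : HexDomainSAW D.carrier δ (a δ) (b δ) |
                γ.curve ∈ CurveClass.modulusClass (1 / (n + 1 : ℝ)) θ} =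
                {γ | γ.curve ∉ CurveClass.modulusClass (1 / (n + 1 : ℝ)) θ}ᶜ := by
              ext γ; simp
            rw [hcompl, probReal_compl_eq_one_sub MeasurableSpace.measurableSet_top]
            linarith
        _ ≤ μ.real U := measureReal_mono hsub
    exact ae_mem_of_one_le_measureReal hUm
      (le_of_forall_pos_le_add fun η hη ↦ by linarith [hge η hη])
  filter_upwards [ae_source_eq_and_target_eq hab hμ, ae_all_iff.2 hmod] with c h1 h2
  exact ⟨h1.2.2, mem_iInter.2 h2⟩

end Simplicity

/-! ### (B) Hull containment and boundary avoidance -/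

section Avoidance

variable {D : DobrushinDomain} {a b : ℝ → HexVertex} {μ : Measure (CurveClass ℂ)}

/-- **Lower half of the restriction sandwich.** If the `hexSAWLaw`-probability that the walk is an
`Ω'`-mesh walk (all vertices in `Ω'`, all edge segments in `cl Ω'`) tends to `p` as `δ → 0⁺`,
then every probability subsequential limit law gives mass `≥ p` to the CLOSED event
`{trace ⊆ cl Ω'}`. [cite: LawlerSchrammWerner2003Restriction, Lemma 3.2 (avoidance probabilities), transposed] -/
theorem le_measureReal_rangeSubset_of_tendsto [IsProbabilityMeasure μ]
    (hμ : IsSubseqLimitLaw (fun δ (γ : HexDomainSAW D.carrier δ (a δ) (b δ)) => γ.curve)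
      (fun δ => hexSAWLaw D.carrier δ (a δ) (b δ)) μ)
    {Ω' : Set ℂ} {p : ℝ}
    (hlim : Tendsto (fun δ : ℝ => ((hexSAWLaw D.carrier δ (a δ) (b δ))
        {γ | (∀ v ∈ γ.walk.support, v ∈ embMeshVertices hexCenter Ω' δ) ∧
          ∀ e ∈ γ.walk.darts, (embMeshGraph hexGraph hexCenter Ω' δ).Adj e.fst e.snd}).toReal)
      (𝓝[>] 0) (𝓝 p)) :
    p ≤ μ.real (CurveClass.rangeSubset (closure Ω')) := by
  refine le_of_forall_lt_imp_le_of_dense fun q hq ↦ ?_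
  refine le_measureReal_of_isClosed hμ (CurveClass.isClosed_rangeSubset isClosed_closure)
    ((hlim.eventually (lt_mem_nhds hq)).mono fun δ hδ hP ↦ hδ.le.trans ?_)
  haveI := hP
  exact measureReal_mono fun γ hγ ↦ curve_mem_rangeSubset_of_meshWalk γ hγ.1 hγ.2

/-- **Boundary avoidance from collars.** If a closed `Z ⊆ ℂ` is avoided by the closures of the sets
`Ω'_j` and the `hexSAWLaw`-probabilities of being an `Ω'_j`-mesh walk tend (as `δ → 0⁺`) to numbers
`p_j → 1`, then `μ`-a.e. limit class has trace disjoint from `Z`.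
[cite: LawlerSchrammWerner2003Restriction, Lemma 3.2 (avoidance probabilities), transposed] -/
theorem ae_disjoint_range_of_tendsto [IsProbabilityMeasure μ]
    (hμ : IsSubseqLimitLaw (fun δ (γ : HexDomainSAW D.carrier δ (a δ) (b δ)) => γ.curve)
      (fun δ => hexSAWLaw D.carrier δ (a δ) (b δ)) μ)
    {Z : Set ℂ} (hZ : IsClosed Z) {Ω' : ℕ → Set ℂ} {p : ℕ → ℝ}
    (hlim : ∀ j, Tendsto (fun δ : ℝ => ((hexSAWLaw D.carrier δ (a δ) (b δ))
        {γ | (∀ v ∈ γ.walk.support, v ∈ embMeshVertices hexCenter (Ω' j) δ) ∧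
          ∀ e ∈ γ.walk.darts, (embMeshGraph hexGraph hexCenter (Ω' j) δ).Adj e.fst e.snd}).toReal)
      (𝓝[>] 0) (𝓝 (p j)))
    (hp : Tendsto p atTop (𝓝 1)) (hΩZ : ∀ j, Disjoint (closure (Ω' j)) Z) :
    ∀ᵐ c ∂μ, Disjoint c.range Z := by
  have hsub : ∀ j, CurveClass.rangeSubset (closure (Ω' j)) ⊆ CurveClass.rangeSubset (E := ℂ) Zᶜ :=
    fun j c hc ↦ (show c.range ⊆ closure (Ω' j) from hc).trans (hΩZ j).subset_compl_right
  have h1 : (1 : ℝ) ≤ μ.real (CurveClass.rangeSubset Zᶜ) :=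
    le_of_tendsto' hp fun j ↦
      (le_measureReal_rangeSubset_of_tendsto hμ (hlim j)).trans (measureReal_mono (hsub j))
  filter_upwards [ae_mem_of_one_le_measureReal
    (CurveClass.measurableSet_rangeSubset_of_isOpen hZ.isOpen_compl) h1] with c hc
  exact disjoint_left.2 fun x hx hxZ ↦ hc hx hxZ

end Avoidance

/-! ### Assembly: the chordal carrier -/

section Assembly

variable {D : DobrushinDomain} {a b : ℝ → HexVertex} {μ : Measure (CurveClass ℂ)}

/-- **Assembly.** A probability subsequential limit law of the critical hexagonal SAW curves in
`(D; a, b)` which is a.e. simple and a.e. misses every boundary piece `frontierPiece D k` is carried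
by `chordalCarrier D` (endpoints and confinement are automatic, (E) and (C)). [folklore] -/
theorem ae_mem_chordalCarrier [IsProbabilityMeasure μ]
    (hab : IsEmbEndpointApprox hexGraph hexCenter D a b)
    (hμ : IsSubseqLimitLaw (fun δ (γ : HexDomainSAW D.carrier δ (a δ) (b δ)) => γ.curve)
      (fun δ => hexSAWLaw D.carrier δ (a δ) (b δ)) μ)
    (hsimple : ∀ᵐ c ∂μ, c ∈ CurveClass.simple)
    (hpiece : ∀ k : ℕ, ∀ᵐ c ∂μ, Disjoint c.range (frontierPiece D k)) :
    ∀ᵐ c ∂μ, c ∈ chordalCarrier D := by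
  filter_upwards [hsimple, ae_source_eq_and_target_eq hab hμ,
    ae_range_subset_closure hμ hab.tendsto_fst hab.tendsto_snd, ae_all_iff.2 hpiece]
    with c h1 h2 h4 h5
  refine ⟨⟨⟨h1, h2.1⟩, h2.2.1⟩, ?_⟩
  show c ∈ {c : CurveClass ℂ | c.range ⊆ D.carrier ∪ {D.pt 0, D.pt 1}}
  rw [setOf_range_subset_eq]
  exact ⟨h4, mem_iInter.2 fun k ↦ (h5 k).subset_compl_right⟩

/-- **Boundary avoidance from collar families.** If every boundary piece `frontierPiece D k` is
covered by two closed sets, each avoided by the closures of a sequence of sets `Ω'_j` whose lattice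
containment probabilities tend to numbers `p_j → 1`, then `μ`-a.e. limit class misses every
boundary piece. [folklore] -/
theorem ae_disjoint_frontierPiece_of_collars [IsProbabilityMeasure μ]
    (hμ : IsSubseqLimitLaw (fun δ (γ : HexDomainSAW D.carrier δ (a δ) (b δ)) => γ.curve)
      (fun δ => hexSAWLaw D.carrier δ (a δ) (b δ)) μ)
    (hcol : ∀ k : ℕ, ∃ Z₁ Z₂ : Set ℂ, IsClosed Z₁ ∧ IsClosed Z₂ ∧
      frontierPiece D k ⊆ Z₁ ∪ Z₂ ∧ ∀ Z ∈ ({Z₁, Z₂} : Set (Set ℂ)),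
        ∃ (Ω' : ℕ → Set ℂ) (p : ℕ → ℝ), Tendsto p atTop (𝓝 1) ∧
          (∀ j, Disjoint (closure (Ω' j)) Z) ∧
          ∀ j, Tendsto (fun δ : ℝ => ((hexSAWLaw D.carrier δ (a δ) (b δ))
            {γ | (∀ v ∈ γ.walk.support, v ∈ embMeshVertices hexCenter (Ω' j) δ) ∧
              ∀ e ∈ γ.walk.darts,
                (embMeshGraph hexGraph hexCenter (Ω' j) δ).Adj e.fst e.snd}).toReal)
            (𝓝[>] 0) (𝓝 (p j))) (k : ℕ) :
    ∀ᵐ c ∂μ, Disjoint c.range (frontierPiece D k) := by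
  obtain ⟨Z₁, Z₂, hZ₁, hZ₂, hcov, hZ⟩ := hcol k
  obtain ⟨Ω₁, p₁, hp₁, hd₁, hl₁⟩ := hZ Z₁ (by simp)
  obtain ⟨Ω₂, p₂, hp₂, hd₂, hl₂⟩ := hZ Z₂ (by simp)
  filter_upwards [ae_disjoint_range_of_tendsto hμ hZ₁ hl₁ hp₁ hd₁,
    ae_disjoint_range_of_tendsto hμ hZ₂ hl₂ hp₂ hd₂] with c h1 h2
  exact Set.disjoint_of_subset_right hcov (h1.union_right h2)

/-- **Registered-shape reduction of stub `stub_chordalCarrier`** (crux item stmt-CriticalPhenomena-10472,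
line `floor-ratio-restriction-bootstrap`).  For ANY Dobrushin domain and endpoint approximation:
the conclusion of the stub — every probability subsequential limit law of the critical hexagonal
SAW curves is carried by `chordalCarrier D` — follows from
(i) the UNIFORM INJECTIVITY MODULUS of the critical SAW (the open range → curve estimate), and
(ii) COLLAR FAMILIES: each boundary piece `frontierPiece D k` is covered by two closed sets, each
avoided by the closures of subsets `Ω'_j` whose `hexSAWLaw`-containment probabilities tend to
numbers `p_j → 1` (on floor domains this is what the stub's hypothesis `FloorRestrictionLimit`
delivers for the hull subdomains of thin half-ellipse hulls, `Φ'_{A_j}(0)^{5/8} → 1`).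
[cite: LawlerSchrammWerner2003Restriction, Lemma 3.2 and Thm. 6.1 (transposed sandwich)] -/
theorem stub_chordalCarrier_reduction :
    ∀ (D : DobrushinDomain) (a b : ℝ → HexVertex), IsEmbEndpointApprox hexGraph hexCenter D a b →
    (∀ ε η : ℝ, 0 < ε → 0 < η → ∃ θ : ℝ, 0 < θ ∧ ∀ᶠ δ : ℝ in 𝓝[>] 0,
      hexSAWLaw D.carrier δ (a δ) (b δ) {γ | γ.curve ∉ CurveClass.modulusClass ε θ} ≤
        ENNReal.ofReal η) →
    (∀ k : ℕ, ∃ Z₁ Z₂ : Set ℂ, IsClosed Z₁ ∧ IsClosed Z₂ ∧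
      frontierPiece D k ⊆ Z₁ ∪ Z₂ ∧ ∀ Z ∈ ({Z₁, Z₂} : Set (Set ℂ)),
        ∃ (Ω' : ℕ → Set ℂ) (p : ℕ → ℝ), Tendsto p atTop (𝓝 1) ∧
          (∀ j, Disjoint (closure (Ω' j)) Z) ∧
          ∀ j, Tendsto (fun δ : ℝ => ((hexSAWLaw D.carrier δ (a δ) (b δ))
            {γ | (∀ v ∈ γ.walk.support, v ∈ embMeshVertices hexCenter (Ω' j) δ) ∧
              ∀ e ∈ γ.walk.darts,
                (embMeshGraph hexGraph hexCenter (Ω' j) δ).Adj e.fst e.snd}).toReal)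
            (𝓝[>] 0) (𝓝 (p j))) →
    ∀ μ : Measure (CurveClass ℂ), IsProbabilityMeasure μ →
      IsSubseqLimitLaw (fun δ (γ : HexDomainSAW D.carrier δ (a δ) (b δ)) => γ.curve)
        (fun δ => hexSAWLaw D.carrier δ (a δ) (b δ)) μ →
      ∀ᵐ c ∂μ, c ∈ chordalCarrier D := by
  intro D a b hab hS hcol μ hμP hμ
  exact ae_mem_chordalCarrier hab hμ (ae_mem_simple_of_uniformModulus hab hμ hS)
    (ae_disjoint_frontierPiece_of_collars hμ hcol)

end Assembly

end Summit.CriticalPhenomena.SAWScalingLimit.Theorems.ObservableToSLE.FloorRatio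

end
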